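import Summits.BirchSwinnertonDyer.Rank1Residual.Partition.EisensteinKernelInertiaLineMult
import Literature.NumberTheory.EllipticCurves.KernelReductionOrdinaryTorsionProofs
import HarnessLib

/-!
# The canonical subgroup at a MULTIPLICATIVE odd `p`, without the Tate curve: the `p`-torsion of the
# kernel of reduction has at most `p` points, hence IS the inertia line

HONEST FRAMING (cell `b2b-bsdres-*`, verbatim): the goal of the cell is to DELETE the
COMBINATION-SHAPED residual classes for ALL analytic-rank ≤ 1 curves over ℚ — "full BSD formula
for every rank ≤ 1 curve in class C" assembled STRICTLY from published theorems — so that the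
rank-≤1 remainder becomes exactly the CONSTRUCTION-SHAPED classes, which are TYPED (missing-input
Props), NOT attempted; this is not "finishing BSD". Off-peak literature typer `b2b-bsdres-lit-cgls`
(CGLS22 / GV00, the reducible = Eisenstein column), session 15, file 4 (complement to files 1–3): an
ELEMENTARY REDUCTION of the Eisenstein column at a multiplicative odd prime — theorems only, no
definition, no named fact, nothing booked, no label changed.

WHY. File 1 (`EisensteinKernelInertiaLineMult`) proved, Tate-free, that at a multiplicative odd `p`
Serre's inertia line `X ≤ E[p]` (`(τ - 1)E[p] ⊆ X`) has order `p` and lies INSIDE the kernel of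
reduction `E₁` of the minimal model at the place `𝔓` (all its non-zero points have `v_𝔓(x) > 1`).
This file proves the reverse inclusion — every `p`-torsion point off the integral locus lies on `X` —
i.e. Serre's statement "`E₁[p]` is the canonical subgroup, of order `p`" (Invent. Math. 15 (1972)
§1.11, Cor. of Prop. 11, height one) at a multiplicative prime, by the COUNT `#(E₁ ∩ E[p]) ≤ p`:

* `natCard_le_of_forall_reducesToZero` — for a globally minimal `W/ℚ`, `p` odd with
  `A_p(W_ℤ mod p) ≠ 0` (good ordinary OR multiplicative reduction), every subgroup `G ≤ E[p]`
  contained in `E₁` has `#G ≤ p`. This is the tree's Newton-polygon count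
  `card_addSubgroup_le_of_hasseCoeff` (`KernelReductionOrdinaryTorsionProofs`: `ΨSq_p` has exactly
  `p - 1` roots of valuation `> 1` when the Hasse invariant is a unit; Serre 1968 IV A.2.2, Silverman
  *AEC* V.3.1(a)), instantiated on `ℚ̄` with the `ℝ≥0`-valued pull-back `|ι ·|_v` of the spectral
  valuation of `\bar ℚ_v` along an embedding `ι : ℚ̄ → \bar ℚ_v` adapted to `𝔓` — which IS the place
  `placeOver p` (tree `mem_placeOver_iff_spectralValuation_le_one`, `PlaceOverInertiaOrbitProofs`);
* `natCard_le_of_forall_reducesToZero_of_mult` — the multiplicative instance (`A_p ≠ 0` at a nodal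
  prime, `X2.UnramifiedLineIntegral.hasseCoeff_integralModelInt_ne_zero_of_mult`);
* **`mem_inertiaLine_iff_one_lt_valuation_of_mult`** — at a multiplicative odd `p`, for the inertia
  line `X` at the place's prime and ANY non-zero `P = (x, y) ∈ E[p]`: `P ∈ X ↔ v_𝔓(x) > 1`; with
  `natCard_reducesToZero_torsion_eq_of_mult`: the `p`-torsion of `E₁` is a line (order `p`).

References: J.-P. Serre, Invent. Math. 15 (1972) §1.11 (Prop. 11, Cor.), §1.12 [SerreInventiones1972];
J.-P. Serre, *Abelian ℓ-adic representations* (1968), IV A.1.2–A.2.2 [SerreAbelianLadic1968];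
J. H. Silverman, *AEC*, GTM 106 (2009), V.3.1(a), VII.2.1, VII.3.1 [SilvermanAEC2009];
HOME/b2b-bsdres-lit-cgls/CGLS-GV-TYPING.md §22.
-/

set_option autoImplicit false

noncomputable section

open scoped Classical NumberField NNReal

open WeierstrassCurve Polynomial Literature.NumberTheory.EllipticCurves
  Literature.NumberTheory.EllipticCurves.Rank1Residual Literature.NumberTheory.GaloisRepresentations
  Field IsDedekindDomain NumberField Rat.HeightOneSpectrum

namespace Summit.BirchSwinnertonDyer.Rank1Residual

namespace KernelDisc

variable {W : WeierstrassCurve ℚ} [W.IsElliptic] [W.IsGloballyMinimal] {p : ℕ} [Fact p.Prime]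

/-- **A subgroup of `E[p]` inside the kernel of reduction has at most `p` elements** (`p` odd,
`A_p(W_ℤ mod p) ≠ 0`: good ordinary or multiplicative reduction at `p`; `W` globally minimal). The
tree's count `card_addSubgroup_le_of_hasseCoeff` over `(ℚ̄, |ι ·|_v)`, the pull-back of the spectral
valuation of `\bar ℚ_v` along an embedding adapted to the place's prime `𝔓`, which cuts out exactly
`𝒪_𝔓 = placeOver p` (`mem_placeOver_iff_spectralValuation_le_one`). Serre 1972 §1.11 (height one:
the points of order `p` of `E₁` form a group of order `p`). [cite: SerreInventiones1972, §1.11 (Cor. of Prop. 11)]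
[cite: SilvermanAEC2009, V.3.1(a) and VII.3.1] -/
theorem natCard_le_of_forall_reducesToZero (hp2 : p ≠ 2)
    (hA : ((integralModelInt W).map (Int.castRingHom (ZMod p))).hasseCoeff p ≠ 0)
    {G : AddSubgroup (geomTorsion W (p : ℤ))}
    (hG : ∀ P ∈ G, WeierstrassCurve.ReducesToZero (placeModel p W)
      (Affine.Point.congrEquiv (placeModel_baseChange p W).symm (P : W.geomPoints))) :
    Nat.card G ≤ p := by
  have hp : p.Prime := Fact.out
  -- the place's prime `𝔓` and an embedding `ι : ℚ̄ → \bar ℚ_v` adapted to it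
  set v := (primesEquiv (R := 𝓞 ℚ)).symm ⟨p, hp⟩ with hvdef
  have hvp : (primesEquiv v : ℕ) = p :=
    congrArg Subtype.val ((primesEquiv (R := 𝓞 ℚ)).apply_symm_apply ⟨p, hp⟩)
  obtain ⟨𝔓, hmem, h𝔓⟩ := exists_ideal_placeOver p hvp
  obtain ⟨𝔐, h𝔐⟩ := v.localPrimesAbove_nonempty
  obtain ⟨ι, hι⟩ := InertiaTame.exists_primeBelow_eq v h𝔓 h𝔐
  obtain ⟨w, hw⟩ := v.exists_spectralValuation
  -- the pulled-back valuation `u = |ι ·|_v` on `ℚ̄`; it cuts out the place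
  set u : Valuation (AlgebraicClosure ℚ) ℝ≥0 := w.comap ι.toRingHom with hudef
  have hu : ∀ z, u z = w (ι z) := fun z ↦ rfl
  have hle1 : ∀ z : AlgebraicClosure ℚ, z ∈ placeOver p ↔ u z ≤ 1 := fun z ↦ by
    rw [hu]; exact mem_placeOver_iff_spectralValuation_le_one p hw h𝔐 ι hmem hι z
  have hlt1 : ∀ z : AlgebraicClosure ℚ, (placeOver p).valuation z < 1 ↔ u z < 1 := fun z ↦ by
    rw [hu]; exact valuation_placeOver_lt_one_iff_spectralValuation_lt_one p hw h𝔐 ι hmem hι z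
  have heq1 : ∀ z : AlgebraicClosure ℚ, (placeOver p).valuation z = 1 ↔ u z = 1 := fun z ↦ by
    rw [hu]; exact valuation_placeOver_eq_one_iff_spectralValuation_eq_one p hw h𝔐 ι hmem hι z
  -- the curve over `ℚ̄` is `u`-integral with unit Hasse invariant
  have hW : W.baseChange (AlgebraicClosure ℚ) =
      (integralModelInt W).map ((algebraMap ℚ (AlgebraicClosure ℚ)).comp (Int.castRingHom ℚ)) := by
    conv_lhs => rw [← map_integralModelInt W]
    rw [baseChange, WeierstrassCurve.map_map]
  have hint : ∀ n : ℤ, ∃ r : u.integer,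
      algebraMap u.integer (AlgebraicClosure ℚ) r = (n : AlgebraicClosure ℚ) := fun n ↦
    ⟨⟨n, (Valuation.mem_integer_iff _ _).mpr ((hle1 _).mp (intCast_mem (placeOver p) n))⟩, rfl⟩
  haveI : (W.baseChange (AlgebraicClosure ℚ)).IsIntegral u.integer := by
    refine isIntegral_of_exists_lift u.integer ?_ ?_ ?_ ?_ ?_
    all_goals
      rw [hW]
      simp only [map_a₁, map_a₂, map_a₃, map_a₄, map_a₆, eq_intCast]
      exact hint _
  have hup : u ((p : ℕ) : AlgebraicClosure ℚ) < 1 := (hlt1 _).mp (valuation_placeOver_natCast_lt_one p)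
  have hpL : ((p : ℕ) : AlgebraicClosure ℚ) ≠ 0 := by exact_mod_cast hp.ne_zero
  have hA' : u ((W.baseChange (AlgebraicClosure ℚ)).hasseCoeff p) = 1 := by
    have h1 : (W.baseChange (AlgebraicClosure ℚ)).hasseCoeff p =
        ((integralModelInt W).hasseCoeff p : AlgebraicClosure ℚ) := by
      rw [hW, map_hasseCoeff, RingHom.comp_apply, eq_intCast, map_intCast]
    have hnd : ¬ (p : ℤ) ∣ (integralModelInt W).hasseCoeff p := by
      intro hd
      apply hA
      rw [map_hasseCoeff, eq_intCast]
      exact (ZMod.intCast_zmod_eq_zero_iff_dvd _ p).mpr hd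
    rw [h1]
    exact (heq1 _).mp (valuation_placeOver_intCast_eq_one p hnd)
  -- `G` seen in `E(ℚ̄)`: finite, killed by `p`, inside `E₁`
  haveI : Finite (geomTorsion W (p : ℤ)) :=
    Nat.finite_of_card_ne_zero (by rw [Rank1Residual.natCard_geomTorsion W p]; exact pow_ne_zero 2 hp.ne_zero)
  have hGe := G.equivMapOfInjective (geomTorsion W (p : ℤ)).subtype
    (geomTorsion W (p : ℤ)).subtype_injective
  set G' : AddSubgroup (W.baseChange (AlgebraicClosure ℚ)).toAffine.Point :=
    G.map (geomTorsion W (p : ℤ)).subtype with hG'def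
  haveI : Finite G' := Finite.of_equiv _ hGe.toEquiv
  have hcard : Nat.card G = Nat.card G' := Nat.card_congr hGe.toEquiv
  have h1 : ∀ (x y : AlgebraicClosure ℚ)
      (h : (W.baseChange (AlgebraicClosure ℚ)).toAffine.Nonsingular x y),
      Affine.Point.some x y h ∈ G' → 1 < u x := by
    intro x y h hxy
    obtain ⟨P, hPG, hPeq⟩ := AddSubgroup.mem_map.mp hxy
    have hlt : 1 < (placeOver p).valuation x :=
      (reducesToZero_place_iff_of_eq_some (W := W) (p := p) hPeq).mp (hG P hPG)
    rw [← not_le, ValuationSubring.valuation_le_one_iff, hle1, not_le] at hlt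
    exact hlt
  have hm : ∀ P ∈ G', (p : ℤ) • P = 0 := by
    intro P hP
    obtain ⟨Q, -, rfl⟩ := AddSubgroup.mem_map.mp hP
    exact (Submodule.mem_torsionBy_iff (p : ℤ) _).mp Q.2
  rw [hcard]
  exact card_addSubgroup_le_of_hasseCoeff u (W.baseChange (AlgebraicClosure ℚ)) hp2 hup hpL hA' G' h1 hm

/-- **At a multiplicative odd `p`, a subgroup of `E[p]` inside the kernel of reduction has at most
`p` elements** (`A_p ≠ 0` at a nodal prime). [cite: SerreInventiones1972, §1.11 (Cor. of Prop. 11) and §1.12] -/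
theorem natCard_le_of_forall_reducesToZero_of_mult (hp2 : p ≠ 2)
    (hmult : W.HasMultiplicativeReductionAtPrime p) {G : AddSubgroup (geomTorsion W (p : ℤ))}
    (hG : ∀ P ∈ G, WeierstrassCurve.ReducesToZero (placeModel p W)
      (Affine.Point.congrEquiv (placeModel_baseChange p W).symm (P : W.geomPoints))) :
    Nat.card G ≤ p :=
  natCard_le_of_forall_reducesToZero hp2
    (X2.UnramifiedLineIntegral.hasseCoeff_integralModelInt_ne_zero_of_mult hp2 hmult) hG

/-- **The canonical subgroup: the inertia line IS the `p`-torsion of the kernel of reduction**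
(multiplicative odd `p`, Tate-free). For the inertia line `X` at the place's prime `𝔓` (`#X ≤ p`,
`(τ - 1)E[p] ⊆ X` for `τ ∈ I_𝔓`) and ANY non-zero `P = (x, y) ∈ E[p]`: `P ∈ X ↔ v_𝔓(x) > 1`.
(⇒ file 1; ⇐ `X ⊆ E₁ ∩ E[p]`, `#X = p ≥ #(E₁ ∩ E[p])`.) Serre 1972 §1.11–1.12: at `e = 1`, height one,
the kernel of reduction meets `E[p]` in the line on which inertia acts by the fundamental character of
level one (`μ_p ⊂` the Tate curve). [cite: SerreInventiones1972, §1.11 (Cor. of Prop. 11) and §1.12 (Cor. of Prop. 13)] -/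
theorem mem_inertiaLine_iff_one_lt_valuation_of_mult (hp2 : p ≠ 2)
    (hmult : W.HasMultiplicativeReductionAtPrime p)
    {𝔓 : Ideal (absIntegers (𝓞 ℚ) ℚ)}
    (hmem : ∀ z : absIntegers (𝓞 ℚ) ℚ, z ∈ 𝔓 ↔ (z : AlgebraicClosure ℚ) ∈ (placeOver p).nonunits)
    {X : AddSubgroup (geomTorsion W (p : ℤ))} (hXcard : Nat.card X ≤ p)
    (hXsub : ∀ τ ∈ 𝔓.inertia (absoluteGaloisGroup ℚ), ∀ P : geomTorsion W (p : ℤ), τ • P - P ∈ X)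
    {P : geomTorsion W (p : ℤ)}
    {x y : AlgebraicClosure ℚ} {h : (W.baseChange (AlgebraicClosure ℚ)).toAffine.Nonsingular x y}
    (hP : (P : W.geomPoints) = Affine.Point.some x y h) :
    P ∈ X ↔ 1 < (placeOver p).valuation x := by
  obtain ⟨hXp, hXred, -⟩ :=
    card_eq_and_reducesToZero_and_exists_smul_ne_of_inertiaLine hp2 hmult hmem hXcard hXsub
  -- the `p`-torsion of the kernel of reduction, as a subgroup of `E[p]`
  set K : AddSubgroup (geomTorsion W (p : ℤ)) :=
    ((WeierstrassCurve.kernelOfReduction (placeModel p W) (integers_placeOver p)).comap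
      (Affine.Point.congrEquiv (placeModel_baseChange p W).symm).toAddMonoidHom).comap
      (geomTorsion W (p : ℤ)).subtype with hKdef
  have hmemK : ∀ Q : geomTorsion W (p : ℤ), Q ∈ K ↔ WeierstrassCurve.ReducesToZero (placeModel p W)
      (Affine.Point.congrEquiv (placeModel_baseChange p W).symm (Q : W.geomPoints)) := fun Q ↦ by
    rw [hKdef]
    exact Iff.rfl
  have hXK : X ≤ K := fun Q hQ ↦ (hmemK Q).mpr (hXred Q hQ)
  have hKcard : Nat.card K ≤ p :=
    natCard_le_of_forall_reducesToZero_of_mult hp2 hmult fun Q hQ ↦ (hmemK Q).mp hQ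
  haveI : Finite (geomTorsion W (p : ℤ)) :=
    Nat.finite_of_card_ne_zero (by
      rw [Rank1Residual.natCard_geomTorsion W p]; exact pow_ne_zero 2 (Fact.out : p.Prime).ne_zero)
  have hXeq : X = K := AddSubgroup.eq_of_le_of_card_ge hXK (by rw [hXp]; exact hKcard)
  rw [hXeq, hmemK, reducesToZero_place_iff_of_eq_some hP]

/-- **The `p`-torsion of the kernel of reduction at a multiplicative odd `p` is a line**: the subgroup
of `E[p]` of points in `E₁` (at the place `𝔓` over `p`, minimal model) has exactly `p` elements — it
is the inertia line of file 1. [cite: SerreInventiones1972, §1.11 (Cor. of Prop. 11)] -/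
theorem natCard_reducesToZero_torsion_eq_of_mult (hp2 : p ≠ 2)
    (hmult : W.HasMultiplicativeReductionAtPrime p) {K : AddSubgroup (geomTorsion W (p : ℤ))}
    (hK : ∀ Q : geomTorsion W (p : ℤ), Q ∈ K ↔ WeierstrassCurve.ReducesToZero (placeModel p W)
      (Affine.Point.congrEquiv (placeModel_baseChange p W).symm (Q : W.geomPoints))) :
    Nat.card K = p := by
  have hp : p.Prime := Fact.out
  set v := (primesEquiv (R := 𝓞 ℚ)).symm ⟨p, hp⟩ with hvdef
  have hvp : (primesEquiv v : ℕ) = p :=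
    congrArg Subtype.val ((primesEquiv (R := 𝓞 ℚ)).apply_symm_apply ⟨p, hp⟩)
  have hv : (p : 𝓞 ℚ) ∈ v.asIdeal := natCast_mem_asIdeal_primesEquiv_symm
  obtain ⟨𝔓, hmem, h𝔓⟩ := exists_ideal_placeOver p hvp
  obtain ⟨X, hXcard, hXsub⟩ := W.exists_addSubgroup_card_le_of_hasMultiplicativeReductionAt hp2 hv
    (hasMultiplicativeReductionAt_of_natCast_mem hmult hv) h𝔓
  obtain ⟨hXp, hXred, -⟩ :=
    card_eq_and_reducesToZero_and_exists_smul_ne_of_inertiaLine hp2 hmult hmem hXcard hXsub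
  have hXK : X ≤ K := fun Q hQ ↦ (hK Q).mpr (hXred Q hQ)
  have hKcard : Nat.card K ≤ p :=
    natCard_le_of_forall_reducesToZero_of_mult hp2 hmult fun Q hQ ↦ (hK Q).mp hQ
  haveI : Finite (geomTorsion W (p : ℤ)) :=
    Nat.finite_of_card_ne_zero (by rw [Rank1Residual.natCard_geomTorsion W p]; exact pow_ne_zero 2 hp.ne_zero)
  have hXeq : X = K := AddSubgroup.eq_of_le_of_card_ge hXK (by rw [hXp]; exact hKcard)
  rw [← hXeq, hXp]

end KernelDisc

end Summit.BirchSwinnertonDyer.Rank1Residual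

end
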